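import Summits.CriticalPhenomena.PercolationContinuityZ3.Theorems.FK.Transplant.KNFreePinning
import Literature.Probability.LatticeModels.RandomClusterExploredWiring
import HarnessLib

/-!
# FK-continuity transplant, FT-05 (iii): the fresh region alone with the seed wired is the worst case
# (Grimmett 2006, Lemma (4.14)(b), lower half, in the one-wired-set formalism)

Cell `fk-continuity` (bschramm), FRONTIER TRANSPLANT sub-cell, registry row FT-05 (`KNFreePinning`); support file
(`--supports stmt-CriticalPhenomena-4575`); builds on p205010 (kernel theorem, internal audit signed; external
expert review pending). HONEST FRAMING: the transplant `ufsc0_of_freeBoundaryHypothesis_r0` this file serves is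
CONDITIONAL on the free-boundary penetration hypothesis FH (open at the same `p` for `q > 1`; ⇔ GRC Conj. (5.103)
via the referee's calibration K1; barrier note `SamePFreeBoundaryCriteria`, Literature/Barriers/CriticalPhenomena);
it is a typed reduction, not a proof of FK continuity. THIS file is unconditional finite-volume measure theory:
no named facts, no sorries, standard axioms; nothing here is specific to `q = 2` or to `d = 3`.

## What is here (the FK replacement of `pinW`/`wireW`, part iii of three)

Kozma–Nitzan (arXiv:2401.12397, §4) condition Bernoulli percolation on the revealed states of finitely many edges
(eq. (30) p. 27: `P(0 ↔ M_x | ω|_D) > 1 - δ`); at `q = 1` the conditional law is again a product measure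
(`prodBernoulli (pinW w F ξ)`, `Literature/Probability/Percolation/KozmaNitzanPinning.lean`). For the random-cluster
measure `φ^B_{𝐩,q} = rcMeasureW w q B` of a finite vertex type (Grimmett 2006, eq. (1.20);
`RandomClusterEdgeWeights.lean`) the conditional law given the states of the edges off a region `F` is again a
measure of the same kind, `rcMeasureW (condWeights w F ξ) q B` (Grimmett 2006, Thm. (3.7) / Lemma (4.13), tree
`rcMeasureW_real_inter_cylinder`): the edges of `F` keep their parameters, the revealed-open edges `ξ` get
parameter `1` (they act as the boundary condition: every revealed cluster is wired into itself), every other edge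
gets parameter `0` (deleted). This is the "per-direction law `P_{R,h}`" of the transplant design (REFUTER-REPORT §8
F4: "fresh edges of `R`, all revealed-open edges kept and wired into their clusters, every other edge deleted").

§5 of the FT-05 toolkit (§1–2, §4: `KNFreePinning.lean`; §3: `KNFreePinningDomainMarkov.lean`): for increasing `A`,
`q ≥ 1`, a revealed-open set `ξ` disjoint from the fresh region `F`, and a vertex set `W` lying inside ONE cluster
of `⟨ξ⟩ ∨ K_B`,
`φ^W_{condWeights w F ∅, q}(A) ≤ φ^B_{condWeights w F ξ, q}(A)` (`rcMeasureW_condWeights_empty_real_le`):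
the random-cluster law of the fresh edges ALONE (everything else deleted) with the seed `W` wired and free elsewhere
lies stochastically below every history-conditioned law whose revealed-open edges join `W`. This is the step "every
look of the exploration is an instance of FH" (memo A §3.2, memo B addendum §1.2): FH bounds the left-hand side
from below once the fresh region contains a box with `W` a wired patch on its boundary. Proof: Holley's inequality
(tree `rcMeasureW_real_le_of_holley`); the parameters compare pointwise (`weight_mul_weight_le_of_le`) and the
cluster counts satisfy the lattice inequality `clusterCount_add_clusterCount_le_of_reachable`
(`k^W(a) + k^B(b) ≤ k^W(a ∩ b) + k^B(a ∪ b)` whenever `W` lies in one cluster of `⟨b⟩ ∨ K_B`) on the support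
`{ξ ⊆ b}` of the larger law. The mirror statement (conditional law BELOW the region law wired on all touched
vertices) is the tree's `rcMeasure_real_inter_cylinder_le_mul_fromEdgeSet` (`RandomClusterConditionalDomination`).

## References

* G. Grimmett, *The Random-Cluster Model*, Springer 2006: eq. (1.20) p. 15; Thm. (2.1) (Holley); Thm. (3.1)(a),
  Thm. (3.7) p. 39; Thm. (3.8), eq. (3.12); Thm. (3.21)–(3.22); §4.2 (4.11)–(4.13), Lemma (4.13) p. 71,
  Lemma (4.14)(b) p. 72. [Grimmett2006]
* G. Kozma, S. Nitzan, arXiv:2401.12397 (2024), §4: p. 20 (total probability over `ξ`), p. 22, p. 27 eq. (30),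
  pp. 30–31 (events `B_j`, (36)–(37)). [KozmaNitzan2024]
* R. Holley, Comm. Math. Phys. 36 (1974) 227–231; Mathlib `Mathlib.Combinatorics.SetFamily.FourFunctions`.
-/

noncomputable section

open MeasureTheory Finset SimpleGraph
open scoped ENNReal Classical

namespace Summit.CriticalPhenomena.PercolationContinuityZ3.Theorems.FK

open Literature.Probability.Percolation (BondConfig openGraph localCylinder DeterminedBy determinedBy_iff)
open Literature.Probability.LatticeModels
open Literature.Probability.Percolation.BHK2006 (weight weight_nonneg ind_inter)
open Literature.Probability.Percolation.DecisionTree (ind ind_of_mem ind_of_not_mem ind_nonneg)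

/-! ## §5 The worst case: the fresh region alone with the seed wired -/

section WorstCase

variable {V : Type*}

/-- **Lattice inequality for a seed inside one revealed cluster**: if every two vertices of `W` are joined in
`⟨b⟩ ∨ K_B`, then `k^W(a) + k^B(b) ≤ k^W(a ∩ b) + k^B(a ∪ b)` for every configuration `a` (wiring `W` adds
nothing to `⟨b⟩ ∨ K_B`; then supermodularity and antitonicity of the number of components, Grimmett 2006 (3.12)).
[cite: Grimmett2006, Thm. (3.8), eq. (3.12)] -/
theorem clusterCount_add_clusterCount_le_of_reachable [Finite V] {a b : BondConfig V} {B W : Set V}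
    (hW : ∀ x ∈ W, ∀ y ∈ W, (openGraph b ⊔ wired B).Reachable x y) :
    clusterCount a W + clusterCount b B ≤ clusterCount (a ∩ b) W + clusterCount (a ∪ b) B := by
  unfold clusterCount
  change Nat.card (fromEdgeSet a ⊔ wired W).ConnectedComponent +
      Nat.card (fromEdgeSet b ⊔ wired B).ConnectedComponent ≤
    Nat.card (fromEdgeSet (a ∩ b) ⊔ wired W).ConnectedComponent +
      Nat.card (fromEdgeSet (a ∪ b) ⊔ wired B).ConnectedComponent
  set G₁ : SimpleGraph V := fromEdgeSet a ⊔ wired W with hG₁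
  set H : SimpleGraph V := fromEdgeSet b ⊔ wired B with hH
  set H' : SimpleGraph V := H ⊔ wired W with hH'
  -- wiring `W` does not change the components of `H`
  have hHH' : Nat.card H.ConnectedComponent = Nat.card H'.ConnectedComponent := by
    refine card_connectedComponent_eq_of_le_of_adj_imp_reachable le_sup_left fun v u hvu => ?_
    rcases hvu with h | h
    · exact h.reachable
    · rw [wired_adj] at h
      exact hW v h.2.1 u h.2.2
  rw [hHH']
  have hsuper := card_connectedComponent_supermodular G₁ H'
  have h1 : fromEdgeSet (a ∩ b) ⊔ wired W ≤ G₁ ⊓ H' := by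
    rw [fromEdgeSet_inter]
    exact sup_le (inf_le_inf le_sup_left (le_sup_left.trans le_sup_left)) (le_inf le_sup_right le_sup_right)
  have h2 : fromEdgeSet (a ∪ b) ⊔ wired B ≤ G₁ ⊔ H' := by
    rw [fromEdgeSet_union]
    exact sup_le (sup_le (le_sup_left.trans le_sup_left) ((le_sup_left.trans le_sup_left).trans le_sup_right))
      ((le_sup_right.trans le_sup_left).trans le_sup_right)
  calc Nat.card G₁.ConnectedComponent + Nat.card H'.ConnectedComponent
      ≤ Nat.card (G₁ ⊓ H').ConnectedComponent + Nat.card (G₁ ⊔ H').ConnectedComponent := hsuper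
    _ ≤ Nat.card (fromEdgeSet (a ∩ b) ⊔ wired W).ConnectedComponent +
          Nat.card (fromEdgeSet (a ∪ b) ⊔ wired B).ConnectedComponent :=
        add_le_add (ConnectedComponent.card_le_card_of_le h1) (ConnectedComponent.card_le_card_of_le h2)

/-- **Product weights of comparable parameters satisfy Holley's condition**: `0 ≤ w₁ ≤ w₂ ≤ 1` pointwise gives
`w₁(a) w₂(b) ≤ w₁(a ∩ b) w₂(a ∪ b)` (edge by edge; the only non-trivial case is `w₁ (1 - w₂) ≤ (1 - w₁) w₂`).
[cite: Grimmett2006, Thm. (2.1) and Thm. (3.21) (proof)] -/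
theorem weight_mul_weight_le_of_le {ι : Type*} [Fintype ι] {w₁ w₂ : ι → ℝ} (h0 : ∀ e, 0 ≤ w₁ e)
    (hle : ∀ e, w₁ e ≤ w₂ e) (h1 : ∀ e, w₂ e ≤ 1) (a b : Set ι) :
    weight w₁ a * weight w₂ b ≤ weight w₁ (a ∩ b) * weight w₂ (a ∪ b) := by
  unfold weight
  rw [← Finset.prod_mul_distrib, ← Finset.prod_mul_distrib]
  refine Finset.prod_le_prod (fun e _ => ?_) fun e _ => ?_
  · have := h0 e; have := hle e; have := h1 e
    refine mul_nonneg ?_ ?_ <;> split_ifs <;> linarith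
  · have hw0 := h0 e; have hw := hle e; have hw1 := h1 e
    by_cases ha : e ∈ a <;> by_cases hb : e ∈ b <;>
      simp only [ha, hb, Set.mem_inter_iff, Set.mem_union, if_true, if_false, and_true, and_false, or_true,
        or_false, le_refl]
    nlinarith

variable [Fintype V] (w : Sym2 V → unitInterval)

/-- **The fresh region alone, with the seed wired, is the worst case** (Grimmett 2006, Lemma (4.14)(b), lower half,
in the tree's one-wired-set formalism; memo A §3.2 / addendum §1.2 "every look is an FH instance"): let `q ≥ 1`, `ξ`
a set of revealed-open edges disjoint from the fresh region `F`, and `W` a vertex set any two of whose vertices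
are joined in `⟨ξ⟩ ∨ K_B` (the seed lies inside ONE revealed cluster, possibly through the wired set `B`). Then
for every increasing event `A`,
`φ^W_{condWeights w F ∅, q}(A) ≤ φ^B_{condWeights w F ξ, q}(A)`:
the random-cluster law of the fresh edges alone (everything else deleted) with `W` wired lies stochastically below
the history-conditioned law. Holley's inequality: the parameters compare pointwise (`∅ ⊆ ξ`) and the cluster
counts satisfy `clusterCount_add_clusterCount_le_of_reachable` on the support `{ξ ⊆ b}` of the larger law.
[cite: Grimmett2006, Lemma (4.14)(b) (p. 72); Thm. (2.1)] -/
theorem rcMeasureW_condWeights_empty_real_le {q : ℝ} (hq : 1 ≤ q) {F ξ : Set (Sym2 V)} (hξ : Disjoint ξ F)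
    {B W : Set V} (hW : ∀ x ∈ W, ∀ y ∈ W, (openGraph ξ ⊔ wired B).Reachable x y)
    {A : Set (BondConfig V)} (hA : IsUpperSet A) :
    (rcMeasureW (condWeights w F ∅) q W).real A ≤ (rcMeasureW (condWeights w F ξ) q B).real A := by
  have hq0 : 0 < q := one_pos.trans_le hq
  refine rcMeasureW_real_le_of_holley hq0 hq0 (fun a b => ?_) hA
  have hle : ∀ e, ((condWeights w F ∅ e : unitInterval) : ℝ) ≤ (condWeights w F ξ e : unitInterval) := fun e =>
    Subtype.coe_le_coe.2 (condWeights_mono_right w F (Set.empty_subset ξ) e)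
  by_cases hb : ξ ⊆ b
  · -- on the support: the cluster inequality is available
    have hWb : ∀ x ∈ W, ∀ y ∈ W, (openGraph b ⊔ wired B).Reachable x y := fun x hx y hy =>
      (hW x hx y hy).mono (sup_le_sup_right (Literature.Probability.Percolation.openGraph_mono hb) _)
    have hk := clusterCount_add_clusterCount_le_of_reachable (a := a) hWb
    have hprod := weight_mul_weight_le_of_le (w₁ := fun e => ((condWeights w F ∅ e : unitInterval) : ℝ))
      (w₂ := fun e => ((condWeights w F ξ e : unitInterval) : ℝ)) (fun e => (condWeights w F ∅ e).2.1) hle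
      (fun e => (condWeights w F ξ e).2.2) a b
    have hqq : q ^ clusterCount a W * q ^ clusterCount b B ≤
        q ^ clusterCount (a ⊓ b) W * q ^ clusterCount (a ⊔ b) B := by
      rw [← pow_add, ← pow_add]
      exact pow_le_pow_right₀ hq hk
    have h0 : 0 ≤ weight (fun e => ((condWeights w F ∅ e : unitInterval) : ℝ)) (a ⊓ b) *
        weight (fun e => ((condWeights w F ξ e : unitInterval) : ℝ)) (a ⊔ b) :=
      mul_nonneg (weight_nonneg (fun e => (condWeights w F ∅ e).2.1) (fun e => (condWeights w F ∅ e).2.2) _)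
        (weight_nonneg (fun e => (condWeights w F ξ e).2.1) (fun e => (condWeights w F ξ e).2.2) _)
    have h0' : 0 ≤ q ^ clusterCount a W * q ^ clusterCount b B := by positivity
    unfold rcWeightW
    calc weight (fun e => ((condWeights w F ∅ e : unitInterval) : ℝ)) a * q ^ clusterCount a W *
          (weight (fun e => ((condWeights w F ξ e : unitInterval) : ℝ)) b * q ^ clusterCount b B)
        = (weight (fun e => ((condWeights w F ∅ e : unitInterval) : ℝ)) a *
            weight (fun e => ((condWeights w F ξ e : unitInterval) : ℝ)) b) *
            (q ^ clusterCount a W * q ^ clusterCount b B) := by ring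
      _ ≤ (weight (fun e => ((condWeights w F ∅ e : unitInterval) : ℝ)) (a ⊓ b) *
            weight (fun e => ((condWeights w F ξ e : unitInterval) : ℝ)) (a ⊔ b)) *
            (q ^ clusterCount (a ⊓ b) W * q ^ clusterCount (a ⊔ b) B) := mul_le_mul hprod hqq h0' h0
      _ = _ := by ring
  · -- off the support: some revealed-open edge is closed in `b`, whose weight therefore vanishes
    obtain ⟨e, heξ, heb⟩ := Set.not_subset.1 hb
    have heF : e ∉ F := fun h => Set.disjoint_left.1 hξ heξ h
    have hzero : weight (fun e => ((condWeights w F ξ e : unitInterval) : ℝ)) b = 0 := by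
      refine Finset.prod_eq_zero (Finset.mem_univ e) ?_
      simp only [if_neg heb]
      rw [coe_condWeights_apply, if_neg heF, if_pos heξ, sub_self]
    have hb0 : rcWeightW (condWeights w F ξ) q B b = 0 := by
      unfold rcWeightW; rw [hzero, zero_mul]
    rw [hb0, mul_zero]
    exact mul_nonneg (rcWeightW_nonneg _ hq0.le _ _) (rcWeightW_nonneg _ hq0.le _ _)

/-- The same comparison when the seed is a single vertex (no reachability hypothesis).
[cite: Grimmett2006, Lemma (4.14)(b) (p. 72)] -/
theorem rcMeasureW_condWeights_empty_real_le_singleton {q : ℝ} (hq : 1 ≤ q) {F ξ : Set (Sym2 V)}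
    (hξ : Disjoint ξ F) (B : Set V) (x : V) {A : Set (BondConfig V)} (hA : IsUpperSet A) :
    (rcMeasureW (condWeights w F ∅) q {x}).real A ≤ (rcMeasureW (condWeights w F ξ) q B).real A :=
  rcMeasureW_condWeights_empty_real_le w hq hξ
    (fun y hy z hz => by
      rw [Set.mem_singleton_iff] at hy hz
      subst hy; subst hz
      exact SimpleGraph.Reachable.refl _) hA

/-- **Free is the worst case among all histories with the same fresh region**: for `q ≥ 1` and increasing `A`,
`φ^B_{condWeights w F ∅, q}(A) ≤ φ^B_{condWeights w F ξ, q}(A)` (all revealed edges closed ≤ any history).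
[cite: Grimmett2006, Lemma (4.14)(b) (p. 72)] -/
theorem rcMeasureW_condWeights_empty_real_le_same {q : ℝ} (hq : 1 ≤ q) (B : Set V) (F ξ : Set (Sym2 V))
    {A : Set (BondConfig V)} (hA : IsUpperSet A) :
    (rcMeasureW (condWeights w F ∅) q B).real A ≤ (rcMeasureW (condWeights w F ξ) q B).real A :=
  rcMeasureW_condWeights_real_mono_right w hq B F (Set.empty_subset ξ) hA

end WorstCase

end Summit.CriticalPhenomena.PercolationContinuityZ3.Theorems.FK

end
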